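/-
Copyright (c) 2026 the pub-hodgecm-mathlib formalisation cell (harness21).  Prover seat hodgecm-mathlib-K2-defs1 (g6), Track B, h413 = `stmt-HodgeConjecture-24833`, route `HCCMUnconditional`,
deal (235)(a) of dealer K2E1-plan (g7) (K2E1-p11's FILE 2, part 2c-A of my 12:53Z plan): the INTEGRAL FORMULA of the archimedean symbol and the phase-control neighbourhood.
-/
import Summits.HodgeConjecture.HodgeConjecture.Theorems.K2E1ArchPureTensorSelfConvolutionU2   -- 📤 2a∕2b (this seat): gauge pure tensor, `hten`∕`hcent`; brings ★ 12d-C, ★ P5c FILE A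
import Summits.HodgeConjecture.HodgeConjecture.Theorems.K2E1ChiEisensteinSolvesXSystemU2    -- ★ row 11 (this seat): `flatSectionU_mul_of_mem_comap`
import HarnessLib

/-!
# (235)(a) FILE 2c-A — `K2E1ArchSymbolFormulaU2`: `∫_G (h_∞ ⊗ 𝟙_U)(y)·F(y) dν_G = κ·μ_f(U)·∫_{G_∞} h_∞(a)·F(ι a) dμ_∞` FOR RIGHT-`U`-INVARIANT `F`; HENCE THE SYMBOL OF A PURE TENSOR ON
# `V(χ, K′, ω)` IS `s(z) = κ μ_f(U) ∫ h_∞(a)·Φ(a)·R(a)^z dμ_∞` (`Φ(a) = φ₀(x₀ιa)∕φ₀(x₀)`, `R(a) = H(x₀ιa)∕H(x₀)`); AND THE PHASE-CONTROL NEIGHBOURHOOD `{½ ≤ Re Φ·R^{z₀}, ½ ≤ Re Φ}`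

Cell `pub/hodgecm-mathlib`, crux H413 = `stmt-HodgeConjecture-24833`.  THEOREMS ONLY (no `def`, no `instance`, no notation, no named-fact hypothesis, no `sorry`); lane `--supports
stmt-HodgeConjecture-24833 --as helper` (count-neutral).  Closes no socket.  Generic `(F, E, c)`, every rank `N`.

THE MATHEMATICS ([BorelJacquet1979, §4.1]; [BernsteinLapid2019, §4 Claim 1]; [Bump1997, proof of Lemma 2.3.2]).  §1: with `∫_G = κ ∫_{G_∞ × G_f}` (★ `exists_integral_eq_smul_integral_adelicProdEquiv`) a pure
tensor `h(y) = h_∞(y_∞)𝟙_U(y_f)` integrates against a right-`ι_f(U)`-invariant `F` as `κ·μ_f(U)·∫ h_∞(a)F(ι a) dμ_∞` (`integral_prod_mul`, `integral_indicator_const`).  §2: for `φ₀ ∈ V(χ,K′,ω)` and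
`ι_f(U) ⊆ K′` acting trivially, `F = f_z^{φ₀}(x₀·)` qualifies (★ `flatSectionU_mul_of_mem_comap`), so an action clause `∫ h·f_z^φ(x·) = s(z)·f_z^φ(x)` evaluated at `(φ₀, x₀)` with `φ₀(x₀) ≠ 0` gives
the INTEGRAL FORMULA `s z = κ μ_f(U) ∫ h_∞(a)·Φ(a)·R(a)^z dμ_∞` with `Φ(a) = φ₀(x₀ ι a)∕φ₀(x₀)`, `R(a) = H(x₀ ι a)∕H(x₀) > 0` (`f_z^φ = φ·H^z`, `(r₁^z)∕(r₂^z) = (r₁∕r₂)^z` for `rᵢ > 0`).  §3: `Φ, R`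
are continuous with `Φ(1) = R(1) = 1` (for continuous `φ₀`), so `{a | ½ ≤ Re(Φ(a)R(a)^{z₀}) ∧ ½ ≤ Re Φ(a)}` is a neighbourhood of `1` in `G_∞` — the input of K2E1-p11's ★ engines
`integral_ne_zero_of_re_ge_half` ∕ `exists_apply_ne_apply_of_secondDiff` (FILE 2c-B).
* §1 **`exists_integral_pureTensor_mul_eq_arch`**.  * §2 `ofReal_cpow_div_ofReal_cpow`, `flatSectionU_mul_div_eq`, **`symbol_eq_integral_arch`**.  * §3 `continuous_phase`, `continuous_ratio`,
  **`setOf_half_le_re_mem_nhds_one`**.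
HONEST LABEL: HC_CM is proved only modulo the 7 printed citations (2 remaining named inputs: hLiu418 = `stmt-HodgeConjecture-24832`, h413 = `stmt-HodgeConjecture-24833`) until rung 0
closes; count-neutral helper, closes no socket.

## References
* [BorelJacquet1979] A. Borel, H. Jacquet, *Automorphic forms and automorphic representations*, Proc. Symp. Pure Math. 33.1 (1979), §4.1.
* [BernsteinLapid2019] J. Bernstein, E. Lapid, *On the meromorphic continuation of Eisenstein series*, J. AMS 37 (2024), §4 Claim 1.  * [Bump1997] D. Bump, *Automorphic Forms and
  Representations* (1997), proof of Lemma 2.3.2.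
-/

set_option autoImplicit false
set_option linter.dupNamespace false  -- the mandated namespace repeats the summit's segment (`HodgeConjecture.HodgeConjecture`)

noncomputable section

open MeasureTheory Measure NumberField NumberField.mixedEmbedding IsDedekindDomain Set Filter Topology
open scoped NNReal MatrixGroups Classical
open Literature.NumberTheory Literature.NumberTheory.Automorphic Literature.NumberTheory.Automorphic.UnitaryGroup AdelicGroupData
open Literature.NumberTheory.GaloisRepresentations (HeckeCharacter)
open Summit.HodgeConjecture.HodgeConjecture.Cruxes.H413.K2E1BorelEisensteinU
open Summit.HodgeConjecture.HodgeConjecture.Cruxes.H413.K2E1CharacterEisensteinU2Defs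
open Summit.HodgeConjecture.HodgeConjecture.Cruxes.H413.K2E1ChiSectionSpaceU2Defs
open Summit.HodgeConjecture.HodgeConjecture.Cruxes.H413.K2E1ChiEisensteinSolvesXSystemU2 (flatSectionU_mul_of_mem_comap)
open Summit.HodgeConjecture.HodgeConjecture.Cruxes.H413.K2E1SphericalHeckeEigenSectionU2 (continuous_borelHeight_coe)

namespace Summit.HodgeConjecture.HodgeConjecture.Cruxes.H413.K2E1ArchSymbolFormulaU2

variable {F E : Type} [Field F] [NumberField F] [Field E] [NumberField E] [Algebra F E] {c : E ≃ₐ[F] E} {N : ℕ} [NeZero N]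

/-! ## §1 `∫_G (h_∞ ⊗ 𝟙_U)·F = κ·μ_f(U)·∫_{G_∞} h_∞·(F ∘ ι)` for right-`ι_f(U)`-invariant `F` -/

section Fubini

variable [MeasurableSpace (quasiSplit F E c N).Adelic] [BorelSpace (quasiSplit F E c N).Adelic]
variable [MeasurableSpace (arch F E c N ((StdForm.antidiagonal N).over E))] [BorelSpace (arch F E c N ((StdForm.antidiagonal N).over E))]
variable [MeasurableSpace (finAdelic F E c N ((StdForm.antidiagonal N).over E))] [BorelSpace (finAdelic F E c N ((StdForm.antidiagonal N).over E))]
variable (νG : Measure (quasiSplit F E c N).Adelic) [νG.IsHaarMeasure]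
variable (μa : Measure (arch F E c N ((StdForm.antidiagonal N).over E))) [μa.IsHaarMeasure]
variable (μf : Measure (finAdelic F E c N ((StdForm.antidiagonal N).over E))) [μf.IsHaarMeasure]

omit [NeZero N] in
/-- **`∫_G (h_∞ ⊗ 𝟙_U)(y)·F(y) dν_G = κ·μ_f(U)·∫_{G_∞} h_∞(a)·F(ι a) dμ_∞`** for EVERY pure tensor `h(y) = h_∞(y_∞)·𝟙_U(y_f)` (`U ⊆ G(𝔸_f)` measurable) and every `F` right-invariant under `ι_f(U)`, with ONE
`κ > 0` (the Haar comparison constant of ★ `exists_integral_eq_smul_integral_adelicProdEquiv`; no integrability needed — both sides use the same junk value). [cite: BorelJacquet1979, §4.1] -/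
theorem exists_integral_pureTensor_mul_eq_arch :
    ∃ κ : ℝ≥0, 0 < κ ∧ ∀ (h : (quasiSplit F E c N).Adelic → ℂ) (hinf : arch F E c N ((StdForm.antidiagonal N).over E) → ℂ) (U : Set (finAdelic F E c N ((StdForm.antidiagonal N).over E))),
      MeasurableSet U → (∀ y, h y = hinf (archPart F E c N _ y) * U.indicator (fun _ => (1 : ℂ)) (finPart F E c N _ y)) →
      ∀ F' : (quasiSplit F E c N).Adelic → ℂ, (∀ y, ∀ b ∈ U, F' (y * finAdelicToAdelic F E c N _ b) = F' y) →
        ∫ y, h y * F' y ∂νG = ((κ : ℝ) : ℂ) * (μf.real U : ℂ) * ∫ a, hinf a * F' (archToAdelic F E c N _ a) ∂μa := by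
  letI : MeasurableSpace (adelic F E c N ((StdForm.antidiagonal N).over E)) := ‹MeasurableSpace (quasiSplit F E c N).Adelic›
  haveI : BorelSpace (adelic F E c N ((StdForm.antidiagonal N).over E)) := ⟨‹BorelSpace (quasiSplit F E c N).Adelic›.measurable_eq⟩
  haveI : @Measure.IsHaarMeasure (↥(adelic F E c N ((StdForm.antidiagonal N).over E))) _ _ _ νG :=
    { lt_top_of_isCompact := fun K hK => IsFiniteMeasureOnCompacts.lt_top_of_isCompact (μ := νG) hK
      map_mul_left_eq_self := fun g => map_mul_left_eq_self νG g
      open_pos := fun U hU hne => IsOpenPosMeasure.open_pos (μ := νG) U hU hne }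
  obtain ⟨κ, hκ, hFub⟩ := exists_integral_eq_smul_integral_adelicProdEquiv F E c N ((StdForm.antidiagonal N).over E) νG μa μf
  haveI := sFinite_haar_finAdelic F E c N ((StdForm.antidiagonal N).over E) μf
  refine ⟨κ, hκ, fun h hinf U hU hten F' hF' => ?_⟩
  have hint : ∀ p : arch F E c N ((StdForm.antidiagonal N).over E) × finAdelic F E c N ((StdForm.antidiagonal N).over E),
      h (archToAdelic F E c N _ p.1 * finAdelicToAdelic F E c N _ p.2) * F' (archToAdelic F E c N _ p.1 * finAdelicToAdelic F E c N _ p.2) =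
        (hinf p.1 * F' (archToAdelic F E c N _ p.1)) * U.indicator (fun _ => (1 : ℂ)) p.2 := by
    rintro ⟨a, b⟩
    dsimp only
    rw [hten, map_mul, map_mul, archPart_archToAdelic, archPart_finAdelicToAdelic, finPart_archToAdelic, finPart_finAdelicToAdelic, mul_one, one_mul]
    by_cases hb : b ∈ U
    · rw [Set.indicator_of_mem hb, hF' _ b hb]; ring
    · rw [Set.indicator_of_notMem hb]; ring
  have step1 : ∫ y, h y * F' y ∂νG = (κ : ℝ) • ∫ p : arch F E c N ((StdForm.antidiagonal N).over E) × finAdelic F E c N ((StdForm.antidiagonal N).over E),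
      h (archToAdelic F E c N _ p.1 * finAdelicToAdelic F E c N _ p.2) * F' (archToAdelic F E c N _ p.1 * finAdelicToAdelic F E c N _ p.2) ∂(μa.prod μf) :=
    hFub (fun y : (quasiSplit F E c N).Adelic => h y * F' y)
  have step2 : ∫ p : arch F E c N ((StdForm.antidiagonal N).over E) × finAdelic F E c N ((StdForm.antidiagonal N).over E),
      (hinf p.1 * F' (archToAdelic F E c N _ p.1)) * U.indicator (fun _ => (1 : ℂ)) p.2 ∂(μa.prod μf) =
        (∫ a, hinf a * F' (archToAdelic F E c N _ a) ∂μa) * ∫ b, U.indicator (fun _ => (1 : ℂ)) b ∂μf :=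
    integral_prod_mul (fun a => hinf a * F' (archToAdelic F E c N _ a)) (U.indicator fun _ => (1 : ℂ))
  rw [step1, integral_congr_ae (Eventually.of_forall hint), step2, integral_indicator_const _ hU, Complex.real_smul, Complex.real_smul, mul_one]
  ring

end Fubini

/-! ## §2 The integral formula of the symbol -/

/-- `(r₁^z)∕(r₂^z) = (r₁∕r₂)^z` for `r₁, r₂ > 0` (principal branch on the positive reals). [folklore] -/
theorem ofReal_cpow_div_ofReal_cpow {r₁ r₂ : ℝ} (h₁ : 0 < r₁) (h₂ : 0 < r₂) (z : ℂ) :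
    ((r₁ : ℂ) ^ z) / ((r₂ : ℂ) ^ z) = (((r₁ / r₂ : ℝ)) : ℂ) ^ z := by
  rw [Complex.cpow_def_of_ne_zero (Complex.ofReal_ne_zero.2 h₁.ne'), Complex.cpow_def_of_ne_zero (Complex.ofReal_ne_zero.2 h₂.ne'),
    Complex.cpow_def_of_ne_zero (Complex.ofReal_ne_zero.2 (div_pos h₁ h₂).ne'), ← Complex.exp_sub, ← Complex.ofReal_log h₁.le, ← Complex.ofReal_log h₂.le,
    ← Complex.ofReal_log (div_pos h₁ h₂).le, Real.log_div h₁.ne' h₂.ne']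
  push_cast
  ring_nf

/-- `f_z^φ(x y)∕f_z^φ(x) = (φ(xy)∕φ(x))·(H(xy)∕H(x))^z` (`f_z^φ = φ·H^z`, `H > 0`). [folklore] -/
theorem flatSectionU_mul_div_eq (φ : (quasiSplit F E c N).Adelic → ℂ) (z : ℂ) (x y : (quasiSplit F E c N).Adelic) :
    flatSectionU φ z (x * y) / flatSectionU φ z x =
      (φ (x * y) / φ x) * ((((((borelHeight (x * y) : ℝ≥0) : ℝ) / ((borelHeight x : ℝ≥0) : ℝ) : ℝ)) : ℂ) ^ z) := by
  rw [flatSectionU_apply, flatSectionU_apply, ← ofReal_cpow_div_ofReal_cpow (by exact_mod_cast borelHeight_pos (x * y)) (by exact_mod_cast borelHeight_pos x) z, mul_div_mul_comm]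

section Formula

variable [MeasurableSpace (quasiSplit F E c N).Adelic] [BorelSpace (quasiSplit F E c N).Adelic]
variable [MeasurableSpace (arch F E c N ((StdForm.antidiagonal N).over E))] [BorelSpace (arch F E c N ((StdForm.antidiagonal N).over E))]
variable [MeasurableSpace (finAdelic F E c N ((StdForm.antidiagonal N).over E))] [BorelSpace (finAdelic F E c N ((StdForm.antidiagonal N).over E))]
variable (νG : Measure (quasiSplit F E c N).Adelic) [νG.IsHaarMeasure]
variable (μa : Measure (arch F E c N ((StdForm.antidiagonal N).over E))) [μa.IsHaarMeasure]
variable (μf : Measure (finAdelic F E c N ((StdForm.antidiagonal N).over E))) [μf.IsHaarMeasure]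
variable {χ : HeckeCharacter E} {K' : Subgroup (quasiSplit F E c N).Adelic} {ω : ↥K' → ℂ}

/-- **THE INTEGRAL FORMULA OF THE SYMBOL**: let `h = h_∞ ⊗ 𝟙_U` be a pure tensor (`hten`) with `ι_f(U) ⊆ K′` acting trivially (`hU`), `K′ ≤ K`, and suppose `s` satisfies the action clause on
`V = chiSectionSpace χ K′ ω` (★ P1∕12d-C).  Then for every `φ₀ ∈ V`, `x₀` with `φ₀(x₀) ≠ 0`, with the universal `κ > 0` of §1:
`s z = κ·μ_f(U)·∫_{G_∞} h_∞(a)·(Φ(a)·R(a)^z) dμ_∞`, `Φ(a) := φ₀(x₀ ι a)∕φ₀(x₀)`, `R(a) := H(x₀ ι a)∕H(x₀)`. [cite: BernsteinLapid2019, §4 Claim 1] [cite: BorelJacquet1979, §4.1] -/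
theorem symbol_eq_integral_arch
    (hK' : K' ≤ ((standardMaximalCompactGL N E).comap (adelicVal F E c N ((StdForm.antidiagonal N).over E)) : Subgroup (quasiSplit F E c N).Adelic))
    {h : (quasiSplit F E c N).Adelic → ℂ} {hinf : arch F E c N ((StdForm.antidiagonal N).over E) → ℂ} {U : Set (finAdelic F E c N ((StdForm.antidiagonal N).over E))}
    (hUm : MeasurableSet U) (hten : ∀ y, h y = hinf (archPart F E c N _ y) * U.indicator (fun _ => (1 : ℂ)) (finPart F E c N _ y))
    (hU : ∀ b ∈ U, ∃ hb : finAdelicToAdelic F E c N ((StdForm.antidiagonal N).over E) b ∈ K', ω ⟨_, hb⟩ = 1)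
    {s : ℂ → ℂ} (hs : ∀ z : ℂ, ∀ φ ∈ chiSectionSpace χ K' ω, ∀ x : (quasiSplit F E c N).Adelic, ∫ y, h y * flatSectionU φ z (x * y) ∂νG = s z * flatSectionU φ z x)
    {φ₀ : (quasiSplit F E c N).Adelic → ℂ} (hφ₀ : φ₀ ∈ chiSectionSpace χ K' ω) {x₀ : (quasiSplit F E c N).Adelic} (hx₀ : φ₀ x₀ ≠ 0) :
    ∃ κ : ℝ≥0, 0 < κ ∧ ∀ z : ℂ, s z = ((κ : ℝ) : ℂ) * (μf.real U : ℂ) *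
      ∫ a, hinf a * ((φ₀ (x₀ * archToAdelic F E c N _ a) / φ₀ x₀) *
        ((((((borelHeight (x₀ * archToAdelic F E c N _ a) : ℝ≥0) : ℝ) / ((borelHeight x₀ : ℝ≥0) : ℝ) : ℝ)) : ℂ) ^ z)) ∂μa := by
  obtain ⟨κ, hκ, hF⟩ := exists_integral_pureTensor_mul_eq_arch νG μa μf
  refine ⟨κ, hκ, fun z => ?_⟩
  have hne : flatSectionU φ₀ z x₀ ≠ 0 := by
    rw [flatSectionU_apply]
    refine mul_ne_zero hx₀ ?_
    rw [Ne, Complex.cpow_eq_zero_iff, not_and_or]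
    exact Or.inl (Complex.ofReal_ne_zero.2 (ne_of_gt (by exact_mod_cast borelHeight_pos x₀)))
  -- `F = f_z^{φ₀}(x₀ ·)` is right-`ι_f(U)`-invariant
  have hF' : ∀ y, ∀ b ∈ U, flatSectionU φ₀ z (x₀ * (y * finAdelicToAdelic F E c N _ b)) = flatSectionU φ₀ z (x₀ * y) := by
    intro y b hb
    obtain ⟨hbK, hωb⟩ := hU b hb
    rw [← mul_assoc, flatSectionU_mul_of_mem_comap hK' hφ₀ z _ ⟨_, hbK⟩, hωb, one_mul]
  have e := hs z φ₀ hφ₀ x₀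
  rw [hF h hinf U hUm hten (fun y => flatSectionU φ₀ z (x₀ * y)) hF'] at e
  -- divide by `f_z^{φ₀}(x₀) ≠ 0`
  have e' : s z = ((κ : ℝ) : ℂ) * (μf.real U : ℂ) * (∫ a, hinf a * flatSectionU φ₀ z (x₀ * archToAdelic F E c N _ a) ∂μa) / flatSectionU φ₀ z x₀ := by
    rw [eq_div_iff hne]; exact e.symm
  rw [e', mul_div_assoc, ← integral_div]
  congr 1
  refine integral_congr_ae (Eventually.of_forall fun a => ?_)
  show hinf a * flatSectionU φ₀ z (x₀ * archToAdelic F E c N _ a) / flatSectionU φ₀ z x₀ = _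
  rw [mul_div_assoc, flatSectionU_mul_div_eq]

end Formula

/-! ## §3 The phase `Φ` and the ratio `R`: continuity and the neighbourhood `{½ ≤ Re(Φ·R^{z₀}), ½ ≤ Re Φ}` of `1` -/

section Phase

omit [NeZero N] in
/-- `a ↦ φ₀(x₀ ι a)∕φ₀(x₀)` is continuous for continuous `φ₀`. [folklore] -/
theorem continuous_phase {φ₀ : (quasiSplit F E c N).Adelic → ℂ} (hφc : Continuous φ₀) (x₀ : (quasiSplit F E c N).Adelic) :
    Continuous fun a : arch F E c N ((StdForm.antidiagonal N).over E) => φ₀ (x₀ * archToAdelic F E c N _ a) / φ₀ x₀ :=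
  (hφc.comp (continuous_const.mul (continuous_archToAdelic F E c N _))).div_const _

/-- `a ↦ H(x₀ ι a)∕H(x₀)` is continuous and positive. [folklore] -/
theorem continuous_ratio (x₀ : (quasiSplit F E c N).Adelic) :
    Continuous fun a : arch F E c N ((StdForm.antidiagonal N).over E) => ((borelHeight (x₀ * archToAdelic F E c N _ a) : ℝ≥0) : ℝ) / ((borelHeight x₀ : ℝ≥0) : ℝ) :=
  (continuous_borelHeight_coe.comp (continuous_const.mul (continuous_archToAdelic F E c N _))).div_const _

/-- `R(a) = H(x₀ ι a)∕H(x₀) > 0`. [folklore] -/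
theorem ratio_pos (x₀ : (quasiSplit F E c N).Adelic) (a : arch F E c N ((StdForm.antidiagonal N).over E)) :
    0 < ((borelHeight (x₀ * archToAdelic F E c N _ a) : ℝ≥0) : ℝ) / ((borelHeight x₀ : ℝ≥0) : ℝ) :=
  div_pos (by exact_mod_cast borelHeight_pos _) (by exact_mod_cast borelHeight_pos _)

/-- **THE PHASE-CONTROL NEIGHBOURHOOD**: for continuous `φ₀` with `φ₀(x₀) ≠ 0` and any `z₀`, the set of `a ∈ G_∞` with `½ ≤ Re(Φ(a)·R(a)^{z₀})` and `½ ≤ Re Φ(a)` is a neighbourhood of `1`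
(both functions are continuous with value `1` at `a = 1`). [cite: Bump1997, proof of Lemma 2.3.2] -/
theorem setOf_half_le_re_mem_nhds_one {φ₀ : (quasiSplit F E c N).Adelic → ℂ} (hφc : Continuous φ₀) {x₀ : (quasiSplit F E c N).Adelic} (hx₀ : φ₀ x₀ ≠ 0) (z₀ : ℂ) :
    {a : arch F E c N ((StdForm.antidiagonal N).over E) |
        (1 / 2 : ℝ) ≤ (φ₀ (x₀ * archToAdelic F E c N _ a) / φ₀ x₀ *
          ((((((borelHeight (x₀ * archToAdelic F E c N _ a) : ℝ≥0) : ℝ) / ((borelHeight x₀ : ℝ≥0) : ℝ) : ℝ)) : ℂ) ^ z₀)).re ∧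
        (1 / 2 : ℝ) ≤ (φ₀ (x₀ * archToAdelic F E c N _ a) / φ₀ x₀).re} ∈ 𝓝 (1 : arch F E c N ((StdForm.antidiagonal N).over E)) := by
  have hΦ := continuous_phase hφc x₀
  have hR := continuous_ratio (F := F) (E := E) (c := c) (N := N) x₀
  have hRz : Continuous fun a : arch F E c N ((StdForm.antidiagonal N).over E) =>
      ((((((borelHeight (x₀ * archToAdelic F E c N _ a) : ℝ≥0) : ℝ) / ((borelHeight x₀ : ℝ≥0) : ℝ) : ℝ)) : ℂ) ^ z₀) :=
    Continuous.cpow (Complex.continuous_ofReal.comp hR) continuous_const fun a => Or.inl (by exact_mod_cast ratio_pos x₀ a)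
  have h1 : Continuous fun a : arch F E c N ((StdForm.antidiagonal N).over E) =>
      (φ₀ (x₀ * archToAdelic F E c N _ a) / φ₀ x₀ * ((((((borelHeight (x₀ * archToAdelic F E c N _ a) : ℝ≥0) : ℝ) / ((borelHeight x₀ : ℝ≥0) : ℝ) : ℝ)) : ℂ) ^ z₀)).re :=
    Complex.continuous_re.comp (hΦ.mul hRz)
  have h2 : Continuous fun a : arch F E c N ((StdForm.antidiagonal N).over E) => (φ₀ (x₀ * archToAdelic F E c N _ a) / φ₀ x₀).re := Complex.continuous_re.comp hΦ
  have hv1 : (φ₀ (x₀ * archToAdelic F E c N _ (1 : arch F E c N ((StdForm.antidiagonal N).over E))) / φ₀ x₀ *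
      ((((((borelHeight (x₀ * archToAdelic F E c N _ (1 : arch F E c N ((StdForm.antidiagonal N).over E))) : ℝ≥0) : ℝ) / ((borelHeight x₀ : ℝ≥0) : ℝ) : ℝ)) : ℂ) ^ z₀)).re = 1 := by
    rw [map_one, mul_one, div_self hx₀, div_self (ne_of_gt (by exact_mod_cast borelHeight_pos x₀)), Complex.ofReal_one, Complex.one_cpow, mul_one, Complex.one_re]
  have hv2 : (φ₀ (x₀ * archToAdelic F E c N _ (1 : arch F E c N ((StdForm.antidiagonal N).over E))) / φ₀ x₀).re = 1 := by
    rw [map_one, mul_one, div_self hx₀, Complex.one_re]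
  have ho1 : {a : arch F E c N ((StdForm.antidiagonal N).over E) | (1 / 2 : ℝ) < (φ₀ (x₀ * archToAdelic F E c N _ a) / φ₀ x₀ *
      ((((((borelHeight (x₀ * archToAdelic F E c N _ a) : ℝ≥0) : ℝ) / ((borelHeight x₀ : ℝ≥0) : ℝ) : ℝ)) : ℂ) ^ z₀)).re} ∈ 𝓝 (1 : arch F E c N ((StdForm.antidiagonal N).over E)) :=
    (isOpen_lt continuous_const h1).mem_nhds (by show (1 / 2 : ℝ) < _; rw [hv1]; norm_num)
  have ho2 : {a : arch F E c N ((StdForm.antidiagonal N).over E) | (1 / 2 : ℝ) < (φ₀ (x₀ * archToAdelic F E c N _ a) / φ₀ x₀).re} ∈ 𝓝 (1 : arch F E c N ((StdForm.antidiagonal N).over E)) :=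
    (isOpen_lt continuous_const h2).mem_nhds (by show (1 / 2 : ℝ) < _; rw [hv2]; norm_num)
  exact Filter.mem_of_superset (Filter.inter_mem ho1 ho2) fun a ha => ⟨le_of_lt ha.1, le_of_lt ha.2⟩

end Phase

end Summit.HodgeConjecture.HodgeConjecture.Cruxes.H413.K2E1ArchSymbolFormulaU2
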